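import Summits.ABC.ABC.Theorems.IUTThetaPilotAbcOfPilotKummer
import Summits.ABC.IUTFork.Cor312NaiveProvPinnedWitness
import Summits.ABC.IUTFork.LDHSlotResidue
import HarnessLib

/-!
# Branch C apex re-based on the campaign-S chain — NON-VACUITY OF ITS SIDE BINDERS AT EVERY GENUINE Θ-VOLUME DATUM
# (companion of `Summits/ABC/ABC/Theorems/IUTThetaPilotAbcOfPilotKummer.lean`, p429014; rung LADDER-ABC:A2.C)

PROOF-ONLY record file of the abc-iut cell (seat abc-iut-w4-d026, gen 4; support piece «C3-APEX-NV», the C3 vacuity-audit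
row asked for by abc-iut-L6-t24 2026-08-26T06:41:12Z). 0 definitions, 0 `Prop` facts, 0 instances. TAKES NO SIDE on
[IUTchIII] Cor. 3.12 (S. Mochizuki, *Inter-universal Teichmüller theory III*, kurims manuscript, Cor. 3.12 statement
p. 173 l. 41 – p. 174 l. 19, proof Step (xi) (xi-e)/(xi-f) p. 183 l. 43 – p. 184 l. 29) or on any author.

THE AUDITED THEOREM. abc-iut-w4-d001's `ThetaPartII.abc_of_pilotKummerIndRelated_of_genEllTwo` derives `_root_.ABC` from
DATA families `(TI, St, Pc, ρ, qK)` indexed by the genuine Θ-volume data `T : Cor22.ThetaVolumeDatumAt P l` of the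
`λ`-line, and the `Prop` families [PIN] `hSet` (provenance `Cor312Prov.IsSettingOf T.D (Pc T)`), `hBridge`, `hPin`
(`PinnedRegions3`) · [CONE] `hKumB` ([IUTchIII] Thm. 3.11 (ii)(b) at column `n`), `hvol` · [READ] `hΘ`
(`(Pc T).negLogTheta ≤ ↑T.negLogTheta`) · [S] `hS` (`PilotKummerIndRelated`) · [SUPPORT] `hG`. The cell's standing rule
(LANA Rem. 8.2.1; skel `ForkChecks`): every fork-level hypothesis set gets a VACUITY AUDIT with a kernel witness — an
implication whose per-datum side binders were jointly unsatisfiable at the genuine data would certify nothing.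

WHAT IS PROVED HERE (all by NAME from landed files; nothing new about [IUTchIII] §3):
1. `negLogTheta_le_genuine_of_encodes` — for EVERY initial Θ-datum `D` ([IUTchI] Def. 3.1), every genuine Θ-volume
   input `I` OF `D` (abc-iut-S2's `ThetaData.IsVolumeInputOf`) and every verbatim Cor.-3.12 setting `P` OF `D`
   (abc-iut-c312-8's `Cor312Prov.IsSettingOf`) whose `−|log(Θ)|` carries the Step-(v) ENCODING
   `−|log(Θ)| = ((ℓ⋇+1)(2ℓ⋇+1)/6)·(−|log(q)|)` (= minus the lgp-degree of the Θ-pilot divisor, Dupuy–Hilado Def. 3.1.1,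
   §3.3; [IUTchIV] Thm. 1.10 Step (v) p. 27–29 "−(j²/2l)·log(q_v)"): `P.negLogTheta ≤ ↑I.negLogTheta`. Chain:
   `IsSettingOf.negLogQ_eq` + `Cor312Prov.negAbsLogQ_eq_neg_absLogq_of_isVolumeInputOf` (the two `q`-sides are ONE number,
   `−(1/2l)·log(q)` of `D`, [IUTchIV] p. 23 l. 27–30) + `PilotData.degLgp_thetaPilot` + the FREE inequality
   `−deĝ̲_lgp(P_Θ) + slotResidue ≤ negLogThetaNonarch I` (abc-iut-S8's `DHData.neg_ndegLgp_add_slotResidue_le_negLogThetaNonarch`,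
   Dupuy–Hilado §4.7, §4.10–4.12: the hull of the union of the possible images contains the bare region) +
   `slotResidue ≥ 0` + the positive archimedean summand (`archLogTheta_pos`, [IUTchIV] Step (vii) p. 30).
2. `exists_sideData_of_datum (T)` — AT EVERY GENUINE Θ-VOLUME DATUM `T` of every `(P, l)`: there are an index skeleton, a
   FULL typed situation `F` of [IUTchIII] Thm. 3.11 with `F.Statement`, a setting `Pc` over it, a region reading `ρ` and a
   q-datum `qK` such that `IsSettingOf T.D Pc ∧ BridgeHyps Pc ∧ KummerB (column n) ∧ PinnedRegions3 ∧ Pc.negLogTheta ≤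
   ↑T.negLogTheta` — EVERY NON-S SIDE BINDER of the apex HOLDS — while `PilotKummerIndRelated` (S) and `Pc.Statement` FAIL
   there. Witness = this seat's gen-3 `NaiveProv.pinned_countermodel_isSettingOf (T.D)` (p427703: the PIN-RESPECTING naive
   countermodel over `T.D`'s own index skeleton, `Cor312NaiveProvPinnedWitness.lean`) + item 1 for the one conjunct not yet in
   the tree (`hΘ`).
3. `apex_sideBinders_satisfiable` / `apex_sideBinders_satisfiable_thm311` — ONE choice of the five data families of
   `abc_of_pilotKummerIndRelated_of_genEllTwo` (resp. of its `FullSituation`-keyed twin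
   `abc_of_thm311_of_pilotKummerIndRelated_of_genEllTwo`) at which `hSet ∧ hBridge ∧ hKumB (resp. hThm311) ∧ hPin ∧ hΘ` hold
   for ALL `(P, l, T)` (no admissibility guard needed) and `hS` FAILS AT EVERY datum: the apex is not an implication from
   falsehood on its side binders, and its content sits ENTIRELY in `hS` (+ `hvol`, + `hG`) — `apex_residual_loadBearing`.

LAYER-LEVEL TWINS (toy/interface level, one place, `ℓ⋇ = 2`): abc-iut-c312-2's `layerC312_of_S_hypotheses_satisfiable` /
`layerC312_without_S_not_derivable` (`Conditional/LayerC312OfSNonVacuity.lean`, p428985) and abc-iut-C-cert-1's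
`abc_of_S_perCurve_hypotheses_satisfiable` (`Conditional/AbcOfSNonVacuity.lean`); this file is the PROVENANCE-level record for
the re-based apex (general `l`, every initial Θ-datum of every genuine datum of the `λ`-line, `hΘ` included).

HONEST SCOPE. Interface + provenance level, exactly as p427703: the witnessing setting lives over the naive `p`-adic
packets of the index skeleton of `T.D` (one prime plays `q_v` at every bad place, volumes at one supported rational place,
cylinders along one packet coordinate, `Ism := {±1}`), NOT over `T.D`'s own local fields / log-shells; `IsSettingOf` pins the
index data and the NUMBER `−|log(q)|`; `hΘ` holds there because the witness's `−|log(Θ)|` is the EXACTLY-SCALED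
`−deĝ̲_lgp(P_Θ)`, which every genuine hull volume dominates. Family-level joint satisfiability of ALL binders INCLUDING `hS`
is not witnessed — by the apex itself such a witness (with `hvol`, `hG`) would prove `ABC`. Nothing here says which reading
of Step (xi) is right; S is an assumption label; typed ≠ proved; instantiated ≠ endorsed.
[cite: Mochizuki2012, IUTchIII Cor. 3.12 p.173–174] [cite: Mochizuki2012, IUTchIV Thm. 1.10 pp.22–31]
[cite: DupuyHilado2025, §3.3, §4.7, §4.10–4.12] [cite: ScholzeStix2018, §2.2 pp. 9–10] [claim: Mochizuki2012, status: disputed]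
for every IUT sentence quoted.
-/

noncomputable section

namespace Summit.ABC.IUTFork.Conditional

namespace ApexNonVacuity

open Literature.NumberTheory.DiophantineGeometry Literature.NumberTheory.DiophantineGeometry.GenEll
open Literature.IUT.LogVolume Literature.IUT.HodgeTheaters NumberField
open Summit.ABC.IUTFork Summit.ABC.IUTFork.Thm311 Summit.ABC.IUTFork.Cor312 Summit.ABC.IUTFork.Cor312Vol
open Summit.ABC.ABC.Theorems

/-! ## 1. The Θ-side reading `hΘ` at every EXACTLY-SCALED setting of an initial Θ-datum -/

section Theta

variable {F K Fbar : Type} [Field F] [NumberField F] [Field K] [NumberField K] [Algebra F K] [Field Fbar]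
  [Algebra F Fbar] [Algebra K Fbar] {E : WeierstrassCurve F} [E.IsElliptic] {l : ℕ} {Pb : BadPlacePredicates K}

/-- **The free Θ-side inequality for a genuine input**: `−deĝ̲_lgp(P_Θ) < −|log(Θ)|(I)` — the lgp-degree of the
Θ-pilot divisor bounds the DEFINED `−|log(Θ)|` of abc-iut-S2's `GenuineLogTheta` strictly from below (free inequality
`−deĝ̲_lgp(P_Θ) + slotResidue ≤ negLogThetaNonarch`, `slotResidue ≥ 0`, archimedean summand `> 0`).
[cite: DupuyHilado2025, §4.7, §4.10–4.12] [cite: Mochizuki2012, IUTchIV Thm. 1.10 Step (vii) p. 30] -/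
theorem neg_ndegLgp_lt_negLogTheta {F₀ : Type} [Field F₀] [NumberField F₀] {K₀ : Type} [Field K₀] [NumberField K₀]
    [Algebra F₀ K₀] (I : ThetaVolumeInput F₀ K₀) :
    -LgpDivisor.ndegLgp I.X.thetaPilot < I.negLogTheta := by
  have h1 := DHData.neg_ndegLgp_add_slotResidue_le_negLogThetaNonarch I
  have h2 := I.X.slotResidue_nonneg I.supportPrimes
  have h3 := ThetaVolumeInput.archLogTheta_pos I.l
  unfold ThetaVolumeInput.negLogTheta
  linarith

/-- **`deĝ̲_lgp(P_Θ) = ((ℓ⋇+1)(2ℓ⋇+1)/6)·deĝ̲(P_q)`** for the pilot data of a genuine input (normalised degrees;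
`PilotData.degLgp_thetaPilot` divided by `[F₀ : ℚ]`). [cite: DupuyHilado2025, Def. 3.1.1, §3.3] -/
theorem ndegLgp_thetaPilot_eq {F₀ : Type} [Field F₀] [NumberField F₀] (X : PilotData F₀) :
    LgpDivisor.ndegLgp X.thetaPilot =
      (((X.lstar : ℝ) + 1) * (2 * X.lstar + 1) / 6) * FinDivisor.ndeg F₀ X.qPilot := by
  rw [LgpDivisor.ndegLgp_eq, PilotData.degLgp_thetaPilot, FinDivisor.ndeg_apply]
  ring

/-- **The Step-(v) weight of a setting OF `D` is the Θ-pilot's average weight of every volume input OF `D`**: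
`stepVWeight T = (ℓ⋇+1)(2ℓ⋇+1)/6` with the SAME `ℓ⋇ = (l−1)/2` (`IsSettingOf.lstar_eq`, `IsVolumeInputOf.X_eq`).
[cite: Mochizuki2012, IUTchI Def. 3.1 (c) p. 61] -/
theorem stepVWeight_eq_of_links (D : InitialThetaData F K Fbar E l Pb)
    {I : ThetaVolumeInput (fieldOfModuli E) K} (hI : ThetaData.IsVolumeInputOf D I)
    {T : ThetaIndex} {S : Situation T} {P : Cor312.Setting S} (hP : Cor312Prov.IsSettingOf D P) :
    stepVWeight T = ((I.X.lstar : ℝ) + 1) * (2 * I.X.lstar + 1) / 6 := by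
  have hl : I.X.lstar = (l - 1) / 2 := by
    rw [hI.X_eq]
    rfl
  have hT : T.lstar = I.X.lstar := by rw [hP.lstar_eq, hl]
  have hne : T.lstar ≠ 0 := by have := T.two_le_lstar; omega
  unfold stepVWeight
  rw [avgWeightAt_sqWeights T.lstar hne, hT]

/-- **At a setting OF `D` carrying the Step-(v) encoding, `−|log(Θ)| = −deĝ̲_lgp(P_Θ)` of every volume input OF `D`**:
`P.negLogTheta = ↑(−deĝ̲_lgp(I.X.thetaPilot))` — the encoded number is exactly minus the lgp-degree of the Θ-pilot (the
`q`-sides are one number by provenance, `Cor312Prov.negAbsLogQ_eq_neg_absLogq_of_isVolumeInputOf` + `IsSettingOf.negLogQ_eq`).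
[cite: Mochizuki2012, IUTchIV Thm. 1.10 p. 23, Step (v) p. 27–29] [claim: Mochizuki2012, status: disputed] -/
theorem negLogTheta_eq_neg_ndegLgp_of_encodes (D : InitialThetaData F K Fbar E l Pb)
    {I : ThetaVolumeInput (fieldOfModuli E) K} (hI : ThetaData.IsVolumeInputOf D I)
    {T : ThetaIndex} {S : Situation T} {P : Cor312.Setting S} (hP : Cor312Prov.IsSettingOf D P)
    (hE : P.negLogTheta = ((stepVWeight T * P.negLogQ : ℝ) : WithTop ℝ)) :
    P.negLogTheta = ((-LgpDivisor.ndegLgp I.X.thetaPilot : ℝ) : WithTop ℝ) := by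
  rw [hE, stepVWeight_eq_of_links D hI hP, ← Cor312Prov.negAbsLogQ_eq_negLogQ_of_links D hI hP,
    ndegLgp_thetaPilot_eq]
  unfold ThetaVolumeInput.negAbsLogQ
  congr 1
  ring

/-- **`hΘ` AT EVERY EXACTLY-SCALED SETTING OF AN INITIAL Θ-DATUM.** For every `D`, every genuine Θ-volume input `I`
OF `D` and every verbatim Cor.-3.12 setting `P` OF `D` whose `−|log(Θ)|` carries the Step-(v) encoding
`−|log(Θ)| = ((ℓ⋇+1)(2ℓ⋇+1)/6)·(−|log(q)|)`: the verbatim `−|log(Θ)|` is at most (indeed strictly below) the input's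
DEFINED `−|log(Θ)|` — `P.negLogTheta ≤ ↑I.negLogTheta`, the apex's `hΘ` reading. PROVED; no side taken.
[cite: Mochizuki2012, IUTchIII Cor. 3.12 p.173–174] [claim: Mochizuki2012, status: disputed] -/
theorem negLogTheta_le_genuine_of_encodes (D : InitialThetaData F K Fbar E l Pb)
    {I : ThetaVolumeInput (fieldOfModuli E) K} (hI : ThetaData.IsVolumeInputOf D I)
    {T : ThetaIndex} {S : Situation T} {P : Cor312.Setting S} (hP : Cor312Prov.IsSettingOf D P)
    (hE : P.negLogTheta = ((stepVWeight T * P.negLogQ : ℝ) : WithTop ℝ)) :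
    P.negLogTheta ≤ ((I.negLogTheta : ℝ) : WithTop ℝ) := by
  rw [negLogTheta_eq_neg_ndegLgp_of_encodes D hI hP hE, WithTop.coe_le_coe]
  exact (neg_ndegLgp_lt_negLogTheta I).le

/-- Strict form: such a setting's `−|log(Θ)|` is STRICTLY below the input's defined `−|log(Θ)|` (the archimedean
summand alone is positive). [cite: Mochizuki2012, IUTchIV Thm. 1.10 Step (vii) p. 30] [claim: Mochizuki2012, status: disputed] -/
theorem negLogTheta_lt_genuine_of_encodes (D : InitialThetaData F K Fbar E l Pb)
    {I : ThetaVolumeInput (fieldOfModuli E) K} (hI : ThetaData.IsVolumeInputOf D I)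
    {T : ThetaIndex} {S : Situation T} {P : Cor312.Setting S} (hP : Cor312Prov.IsSettingOf D P)
    (hE : P.negLogTheta = ((stepVWeight T * P.negLogQ : ℝ) : WithTop ℝ)) :
    P.negLogTheta < ((I.negLogTheta : ℝ) : WithTop ℝ) := by
  rw [negLogTheta_eq_neg_ndegLgp_of_encodes D hI hP hE, WithTop.coe_lt_coe]
  exact neg_ndegLgp_lt_negLogTheta I

end Theta

/-! ## 2. At one genuine Θ-volume datum of the `λ`-line: every non-S side binder of the apex is inhabited -/

/-- **EVERY NON-S SIDE BINDER OF THE APEX IS JOINTLY INHABITED AT EVERY GENUINE Θ-VOLUME DATUM — WITH S FALSE THERE.**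
For every `T : Cor22.ThetaVolumeDatumAt P l` there are an index skeleton `TI`, a FULL typed situation `F` of [IUTchIII]
Thm. 3.11 with `F.Statement` (hence (ii)(b) `KummerB` at every column), a verbatim Cor.-3.12 setting `Pc` over it ATTACHED TO
`T.D` (`Cor312Prov.IsSettingOf`), a region reading `ρ` and a q-datum `qK` such that the bridge hypotheses, `KummerB` at column
`n`, THE THREE PINS `PinnedRegions3` and the Θ-side reading `Pc.negLogTheta ≤ ↑T.negLogTheta` ALL HOLD, `|log(q)| > 0`, and the
residual `PilotKummerIndRelated` (S) and the verbatim `Pc.Statement` FAIL. Witness: `NaiveProv.pinned_countermodel_isSettingOf T.D`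
(p427703) + `negLogTheta_le_genuine_of_encodes`. Interface + provenance level (module docstring HONEST SCOPE); no side taken.
[cite: Mochizuki2012, IUTchIII Cor. 3.12 p.173–174] [claim: Mochizuki2012, status: disputed] -/
theorem exists_sideData_of_datum {P : NFPoint} {l : ℕ} (T : Cor22.ThetaVolumeDatumAt P l) :
    ∃ (TI : ThetaIndex) (F : FullSituation TI) (Pc : Cor312.Setting F.toLatticeSituation.toSituation)
      (ρ : (∀ v : TI.V, v ∈ TI.Vbad → Set (F.L.StarPacket v)) → ∀ (j : TI.Label) (vQ : TI.VQ), Set (F.L.Packet j vQ))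
      (qK : ∀ v : TI.V, v ∈ TI.Vbad → Set (F.L.StarPacket v)),
      (letI := T.instFieldF; letI := T.instNumberFieldF; letI := T.instAlgebraF; letI := T.instFieldK
        letI := T.instNumberFieldK; letI := T.instAlgebraK; letI := T.instFieldFbar; letI := T.instAlgebraFbar
        letI := T.instAlgebraKFbar; letI := T.instIsElliptic
        Cor312Prov.IsSettingOf T.D Pc) ∧
      F.Statement ∧ BridgeHyps Pc ∧ (F.toLatticeSituation.col Pc.n).KummerB (F.toLatticeSituation.D Pc.n) ∧
      PinnedRegions3 F.toLatticeSituation Pc ρ qK ∧ Pc.negLogTheta ≤ ((T.negLogTheta : ℝ) : WithTop ℝ) ∧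
      Pc.AbsLogQPos ∧ ¬ PilotKummerIndRelated F.toLatticeSituation Pc ρ qK ∧ ¬ Pc.Statement := by
  letI := T.instFieldF; letI := T.instNumberFieldF; letI := T.instAlgebraF; letI := T.instFieldK
  letI := T.instNumberFieldK; letI := T.instAlgebraK; letI := T.instFieldFbar; letI := T.instAlgebraFbar
  letI := T.instAlgebraKFbar; letI := T.instIsElliptic
  obtain ⟨F₁, Pc, ρ, qK, hSet, hF, -, -, -, -, hB, hA, hE, hpin, -, -, -, hS, -, -, hSt, -, -, -⟩ :=
    NaiveProv.pinned_countermodel_isSettingOf T.D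
  exact ⟨_, F₁, Pc, ρ, qK, hSet, hF, hB, GluedMonoids.kummerB_of_statement F₁ hF Pc.n, hpin,
    negLogTheta_le_genuine_of_encodes T.D T.isVolumeInputOf hSet hE, hA, hS, hSt⟩

/-- **The per-datum engine of the apex is LOAD-BEARING in S**: at the witnessing data of `exists_sideData_of_datum` every
hypothesis of abc-iut-w4-d001's `cor312Of_datum_of_pilotKummerIndRelated` other than `hS` holds, yet abc-iut-w5-d230's
`statement_of_pinned3_of_pilotKummerIndRelated` (its first step) cannot fire — its conclusion `Pc.Statement` is FALSE there; so
the schema «provenance + bridge + (ii)(b) + pins + hΘ ⟹ verbatim Statement» is NOT a theorem of the frozen vocabulary, and the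
[S] binder cannot be dropped from the apex. (Nothing is said about `T.Cor312Of` — the inequality between the datum's two DEFINED
numbers — which no file in the tree decides.) [cite: Mochizuki2012, IUTchIII Cor. 3.12 p.173–174] [claim: Mochizuki2012, status: disputed] -/
theorem sideBinders_not_imp_statement {P : NFPoint} {l : ℕ} (T : Cor22.ThetaVolumeDatumAt P l) :
    ¬ ∀ (TI : ThetaIndex) (F : FullSituation TI) (Pc : Cor312.Setting F.toLatticeSituation.toSituation)
        (ρ : (∀ v : TI.V, v ∈ TI.Vbad → Set (F.L.StarPacket v)) → ∀ (j : TI.Label) (vQ : TI.VQ), Set (F.L.Packet j vQ))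
        (qK : ∀ v : TI.V, v ∈ TI.Vbad → Set (F.L.StarPacket v)),
        (letI := T.instFieldF; letI := T.instNumberFieldF; letI := T.instAlgebraF; letI := T.instFieldK
          letI := T.instNumberFieldK; letI := T.instAlgebraK; letI := T.instFieldFbar; letI := T.instAlgebraFbar
          letI := T.instAlgebraKFbar; letI := T.instIsElliptic
          Cor312Prov.IsSettingOf T.D Pc) →
        F.Statement → BridgeHyps Pc → (F.toLatticeSituation.col Pc.n).KummerB (F.toLatticeSituation.D Pc.n) →
        PinnedRegions3 F.toLatticeSituation Pc ρ qK → Pc.negLogTheta ≤ ((T.negLogTheta : ℝ) : WithTop ℝ) →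
        Pc.Statement := by
  intro h
  obtain ⟨TI, F, Pc, ρ, qK, hSet, hF, hB, hK, hpin, hΘ, -, -, hSt⟩ := exists_sideData_of_datum T
  exact hSt (h TI F Pc ρ qK hSet hF hB hK hpin hΘ)

/-! ## 3. The apex's five data families: ONE choice satisfying every non-S binder everywhere, with S false everywhere -/

/-- **THE SIDE BINDERS OF `abc_of_pilotKummerIndRelated_of_genEllTwo` ARE JOINTLY SATISFIABLE — at ONE choice of its five data
families `(TI, St, Pc, ρ, qK)`, for ALL `(P, l, T)` (no admissibility guard needed): `hSet ∧ hBridge ∧ hKumB ∧ hPin ∧ hΘ` in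
the apex's own binder shapes — and AT THAT CHOICE `hS` FAILS AT EVERY DATUM.** Consequently the apex is not an implication from
falsehood on its side binders, and what it asks of [S] is visible: at these (interface + provenance level) data S is refuted, so
any supplier of `hS` must come with OTHER setting data (branch B's census), not from the typed interface. No side taken.
[cite: Mochizuki2012, IUTchIII Cor. 3.12 p.173–174] [cite: Mochizuki2012, IUTchIV Cor. 2.2–2.3 pp.41–55]
[claim: Mochizuki2012, status: disputed] -/
theorem apex_sideBinders_satisfiable :
    ∃ (TI : ∀ {P : NFPoint} {l : ℕ}, Cor22.ThetaVolumeDatumAt P l → ThetaIndex)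
      (St : ∀ {P : NFPoint} {l : ℕ} (T : Cor22.ThetaVolumeDatumAt P l), LatticeSituation (TI T))
      (Pc : ∀ {P : NFPoint} {l : ℕ} (T : Cor22.ThetaVolumeDatumAt P l), Cor312.Setting (St T).toSituation)
      (ρ : ∀ {P : NFPoint} {l : ℕ} (T : Cor22.ThetaVolumeDatumAt P l),
        (∀ v : (TI T).V, v ∈ (TI T).Vbad → Set ((St T).L.StarPacket v)) →
          ∀ (j : (TI T).Label) (vQ : (TI T).VQ), Set ((St T).L.Packet j vQ))
      (qK : ∀ {P : NFPoint} {l : ℕ} (T : Cor22.ThetaVolumeDatumAt P l),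
        ∀ v : (TI T).V, v ∈ (TI T).Vbad → Set ((St T).L.StarPacket v)),
      (∀ P : NFPoint, P ∈ UP → ∀ l : ℕ, l.Prime → 5 ≤ l →
        Cor22.AdmitsCore P → Cor22.CondP2 P l → Cor22.CondP5 P l → Cor22.CondP6 P l →
        ∀ T : Cor22.ThetaVolumeDatumAt P l,
          letI := T.instFieldF; letI := T.instNumberFieldF; letI := T.instAlgebraF; letI := T.instFieldK
          letI := T.instNumberFieldK; letI := T.instAlgebraK; letI := T.instFieldFbar; letI := T.instAlgebraFbar
          letI := T.instAlgebraKFbar; letI := T.instIsElliptic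
          Cor312Prov.IsSettingOf T.D (Pc T)) ∧
      (∀ P : NFPoint, P ∈ UP → ∀ l : ℕ, l.Prime → 5 ≤ l →
        Cor22.AdmitsCore P → Cor22.CondP2 P l → Cor22.CondP5 P l → Cor22.CondP6 P l →
        ∀ T : Cor22.ThetaVolumeDatumAt P l, BridgeHyps (Pc T)) ∧
      (∀ P : NFPoint, P ∈ UP → ∀ l : ℕ, l.Prime → 5 ≤ l →
        Cor22.AdmitsCore P → Cor22.CondP2 P l → Cor22.CondP5 P l → Cor22.CondP6 P l →
        ∀ T : Cor22.ThetaVolumeDatumAt P l, ((St T).col (Pc T).n).KummerB ((St T).D (Pc T).n)) ∧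
      (∀ P : NFPoint, P ∈ UP → ∀ l : ℕ, l.Prime → 5 ≤ l →
        Cor22.AdmitsCore P → Cor22.CondP2 P l → Cor22.CondP5 P l → Cor22.CondP6 P l →
        ∀ T : Cor22.ThetaVolumeDatumAt P l, PinnedRegions3 (St T) (Pc T) (ρ T) (qK T)) ∧
      (∀ P : NFPoint, P ∈ UP → ∀ l : ℕ, l.Prime → 5 ≤ l →
        Cor22.AdmitsCore P → Cor22.CondP2 P l → Cor22.CondP5 P l → Cor22.CondP6 P l →
        ∀ T : Cor22.ThetaVolumeDatumAt P l, (Pc T).negLogTheta ≤ ((T.negLogTheta : ℝ) : WithTop ℝ)) ∧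
      (∀ {P : NFPoint} {l : ℕ} (T : Cor22.ThetaVolumeDatumAt P l),
        ¬ PilotKummerIndRelated (St T) (Pc T) (ρ T) (qK T)) := by
  classical
  -- choose, datum by datum, the witnessing data of `exists_sideData_of_datum`
  let TI : ∀ {P : NFPoint} {l : ℕ}, Cor22.ThetaVolumeDatumAt P l → ThetaIndex :=
    fun T => (exists_sideData_of_datum T).choose
  let F : ∀ {P : NFPoint} {l : ℕ} (T : Cor22.ThetaVolumeDatumAt P l), FullSituation (TI T) :=
    fun T => (exists_sideData_of_datum T).choose_spec.choose
  let Pc : ∀ {P : NFPoint} {l : ℕ} (T : Cor22.ThetaVolumeDatumAt P l),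
      Cor312.Setting (F T).toLatticeSituation.toSituation :=
    fun T => (exists_sideData_of_datum T).choose_spec.choose_spec.choose
  let ρ : ∀ {P : NFPoint} {l : ℕ} (T : Cor22.ThetaVolumeDatumAt P l),
      (∀ v : (TI T).V, v ∈ (TI T).Vbad → Set ((F T).L.StarPacket v)) →
        ∀ (j : (TI T).Label) (vQ : (TI T).VQ), Set ((F T).L.Packet j vQ) :=
    fun T => (exists_sideData_of_datum T).choose_spec.choose_spec.choose_spec.choose
  let qK : ∀ {P : NFPoint} {l : ℕ} (T : Cor22.ThetaVolumeDatumAt P l),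
      ∀ v : (TI T).V, v ∈ (TI T).Vbad → Set ((F T).L.StarPacket v) :=
    fun T => (exists_sideData_of_datum T).choose_spec.choose_spec.choose_spec.choose_spec.choose
  have H : ∀ {P : NFPoint} {l : ℕ} (T : Cor22.ThetaVolumeDatumAt P l),
      (letI := T.instFieldF; letI := T.instNumberFieldF; letI := T.instAlgebraF; letI := T.instFieldK
        letI := T.instNumberFieldK; letI := T.instAlgebraK; letI := T.instFieldFbar; letI := T.instAlgebraFbar
        letI := T.instAlgebraKFbar; letI := T.instIsElliptic
        Cor312Prov.IsSettingOf T.D (Pc T)) ∧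
      (F T).Statement ∧ BridgeHyps (Pc T) ∧
      ((F T).toLatticeSituation.col (Pc T).n).KummerB ((F T).toLatticeSituation.D (Pc T).n) ∧
      PinnedRegions3 (F T).toLatticeSituation (Pc T) (ρ T) (qK T) ∧
      (Pc T).negLogTheta ≤ ((T.negLogTheta : ℝ) : WithTop ℝ) ∧ (Pc T).AbsLogQPos ∧
      ¬ PilotKummerIndRelated (F T).toLatticeSituation (Pc T) (ρ T) (qK T) ∧ ¬ (Pc T).Statement :=
    fun T => (exists_sideData_of_datum T).choose_spec.choose_spec.choose_spec.choose_spec.choose_spec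
  refine ⟨fun T => TI T, fun T => (F T).toLatticeSituation, fun T => Pc T, fun T => ρ T, fun T => qK T,
    fun P _ l _ _ _ _ _ _ T => (H T).1, fun P _ l _ _ _ _ _ _ T => (H T).2.2.1,
    fun P _ l _ _ _ _ _ _ T => (H T).2.2.2.1, fun P _ l _ _ _ _ _ _ T => (H T).2.2.2.2.1,
    fun P _ l _ _ _ _ _ _ T => (H T).2.2.2.2.2.1, fun T => (H T).2.2.2.2.2.2.2.1⟩

/-- **The same for the `FullSituation`-keyed twin `abc_of_thm311_of_pilotKummerIndRelated_of_genEllTwo`** (branch C's v0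
binder names: `F`, `Pc`, `ρ`, `qK`, `hSet`, `hBridge`, `hThm311`, `hPin`, `hΘ`, `hS`): ONE choice of the data families with
`hSet ∧ hBridge ∧ hThm311 ((F T).Statement — the typed Theorem 3.11 (i)∧(ii)∧(iii) HOLDS at the witness) ∧ hPin ∧ hΘ` for all
`(P, l, T)`, at which `hS` fails at every datum. No side taken. [cite: Mochizuki2012, IUTchIII Thm. 3.11 pp.153–158, Cor. 3.12
p.173–174] [claim: Mochizuki2012, status: disputed] -/
theorem apex_sideBinders_satisfiable_thm311 :
    ∃ (TI : ∀ {P : NFPoint} {l : ℕ}, Cor22.ThetaVolumeDatumAt P l → ThetaIndex)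
      (F : ∀ {P : NFPoint} {l : ℕ} (T : Cor22.ThetaVolumeDatumAt P l), FullSituation (TI T))
      (Pc : ∀ {P : NFPoint} {l : ℕ} (T : Cor22.ThetaVolumeDatumAt P l),
        Cor312.Setting (F T).toLatticeSituation.toSituation)
      (ρ : ∀ {P : NFPoint} {l : ℕ} (T : Cor22.ThetaVolumeDatumAt P l),
        (∀ v : (TI T).V, v ∈ (TI T).Vbad → Set ((F T).L.StarPacket v)) →
          ∀ (j : (TI T).Label) (vQ : (TI T).VQ), Set ((F T).L.Packet j vQ))
      (qK : ∀ {P : NFPoint} {l : ℕ} (T : Cor22.ThetaVolumeDatumAt P l),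
        ∀ v : (TI T).V, v ∈ (TI T).Vbad → Set ((F T).L.StarPacket v)),
      (∀ P : NFPoint, P ∈ UP → ∀ l : ℕ, l.Prime → 5 ≤ l →
        Cor22.AdmitsCore P → Cor22.CondP2 P l → Cor22.CondP5 P l → Cor22.CondP6 P l →
        ∀ T : Cor22.ThetaVolumeDatumAt P l,
          letI := T.instFieldF; letI := T.instNumberFieldF; letI := T.instAlgebraF; letI := T.instFieldK
          letI := T.instNumberFieldK; letI := T.instAlgebraK; letI := T.instFieldFbar; letI := T.instAlgebraFbar
          letI := T.instAlgebraKFbar; letI := T.instIsElliptic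
          Cor312Prov.IsSettingOf T.D (Pc T)) ∧
      (∀ P : NFPoint, P ∈ UP → ∀ l : ℕ, l.Prime → 5 ≤ l →
        Cor22.AdmitsCore P → Cor22.CondP2 P l → Cor22.CondP5 P l → Cor22.CondP6 P l →
        ∀ T : Cor22.ThetaVolumeDatumAt P l, BridgeHyps (Pc T)) ∧
      (∀ P : NFPoint, P ∈ UP → ∀ l : ℕ, l.Prime → 5 ≤ l →
        Cor22.AdmitsCore P → Cor22.CondP2 P l → Cor22.CondP5 P l → Cor22.CondP6 P l →
        ∀ T : Cor22.ThetaVolumeDatumAt P l, (F T).Statement) ∧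
      (∀ P : NFPoint, P ∈ UP → ∀ l : ℕ, l.Prime → 5 ≤ l →
        Cor22.AdmitsCore P → Cor22.CondP2 P l → Cor22.CondP5 P l → Cor22.CondP6 P l →
        ∀ T : Cor22.ThetaVolumeDatumAt P l, PinnedRegions3 (F T).toLatticeSituation (Pc T) (ρ T) (qK T)) ∧
      (∀ P : NFPoint, P ∈ UP → ∀ l : ℕ, l.Prime → 5 ≤ l →
        Cor22.AdmitsCore P → Cor22.CondP2 P l → Cor22.CondP5 P l → Cor22.CondP6 P l →
        ∀ T : Cor22.ThetaVolumeDatumAt P l, (Pc T).negLogTheta ≤ ((T.negLogTheta : ℝ) : WithTop ℝ)) ∧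
      (∀ {P : NFPoint} {l : ℕ} (T : Cor22.ThetaVolumeDatumAt P l),
        ¬ PilotKummerIndRelated (F T).toLatticeSituation (Pc T) (ρ T) (qK T)) := by
  classical
  let TI : ∀ {P : NFPoint} {l : ℕ}, Cor22.ThetaVolumeDatumAt P l → ThetaIndex :=
    fun T => (exists_sideData_of_datum T).choose
  let F : ∀ {P : NFPoint} {l : ℕ} (T : Cor22.ThetaVolumeDatumAt P l), FullSituation (TI T) :=
    fun T => (exists_sideData_of_datum T).choose_spec.choose
  let Pc : ∀ {P : NFPoint} {l : ℕ} (T : Cor22.ThetaVolumeDatumAt P l),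
      Cor312.Setting (F T).toLatticeSituation.toSituation :=
    fun T => (exists_sideData_of_datum T).choose_spec.choose_spec.choose
  let ρ : ∀ {P : NFPoint} {l : ℕ} (T : Cor22.ThetaVolumeDatumAt P l),
      (∀ v : (TI T).V, v ∈ (TI T).Vbad → Set ((F T).L.StarPacket v)) →
        ∀ (j : (TI T).Label) (vQ : (TI T).VQ), Set ((F T).L.Packet j vQ) :=
    fun T => (exists_sideData_of_datum T).choose_spec.choose_spec.choose_spec.choose
  let qK : ∀ {P : NFPoint} {l : ℕ} (T : Cor22.ThetaVolumeDatumAt P l),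
      ∀ v : (TI T).V, v ∈ (TI T).Vbad → Set ((F T).L.StarPacket v) :=
    fun T => (exists_sideData_of_datum T).choose_spec.choose_spec.choose_spec.choose_spec.choose
  have H : ∀ {P : NFPoint} {l : ℕ} (T : Cor22.ThetaVolumeDatumAt P l),
      (letI := T.instFieldF; letI := T.instNumberFieldF; letI := T.instAlgebraF; letI := T.instFieldK
        letI := T.instNumberFieldK; letI := T.instAlgebraK; letI := T.instFieldFbar; letI := T.instAlgebraFbar
        letI := T.instAlgebraKFbar; letI := T.instIsElliptic
        Cor312Prov.IsSettingOf T.D (Pc T)) ∧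
      (F T).Statement ∧ BridgeHyps (Pc T) ∧
      ((F T).toLatticeSituation.col (Pc T).n).KummerB ((F T).toLatticeSituation.D (Pc T).n) ∧
      PinnedRegions3 (F T).toLatticeSituation (Pc T) (ρ T) (qK T) ∧
      (Pc T).negLogTheta ≤ ((T.negLogTheta : ℝ) : WithTop ℝ) ∧ (Pc T).AbsLogQPos ∧
      ¬ PilotKummerIndRelated (F T).toLatticeSituation (Pc T) (ρ T) (qK T) ∧ ¬ (Pc T).Statement :=
    fun T => (exists_sideData_of_datum T).choose_spec.choose_spec.choose_spec.choose_spec.choose_spec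
  refine ⟨fun T => TI T, fun T => F T, fun T => Pc T, fun T => ρ T, fun T => qK T,
    fun P _ l _ _ _ _ _ _ T => (H T).1, fun P _ l _ _ _ _ _ _ T => (H T).2.2.1,
    fun P _ l _ _ _ _ _ _ T => (H T).2.1, fun P _ l _ _ _ _ _ _ T => (H T).2.2.2.2.1,
    fun P _ l _ _ _ _ _ _ T => (H T).2.2.2.2.2.1, fun T => (H T).2.2.2.2.2.2.2.1⟩

/-- **WHERE THE APEX'S CONTENT SITS (load-bearing record).** With the data families of `apex_sideBinders_satisfiable`, every
side binder of `abc_of_pilotKummerIndRelated_of_genEllTwo` is discharged and the theorem specialises to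
`(∀ admissible P l T, S at these data) → hvol → hG → ABC`; but its S-antecedent is REFUTED at every datum, so at these data the
apex can only be invoked if NO admissible genuine Θ-volume datum exists at all. Recorded as: for every admissible `(P, l)` at
which a genuine datum exists (`Cor22.ThetaDataExistsAt P l`, the crux's child (i)), the ∀-guarded S-hypothesis of the apex FAILS
at the witnessing families. Honest reading: the apex's mathematical content is exactly `hS` (+ `hvol` + `hG`); the side binders
cost nothing at interface + provenance level. No side taken. [cite: Mochizuki2012, IUTchIII Cor. 3.12 p.173–174]
[claim: Mochizuki2012, status: disputed] -/
theorem apex_residual_loadBearing {P₀ : NFPoint} {l₀ : ℕ} (hP : P₀ ∈ UP) (hl : l₀.Prime) (h5 : 5 ≤ l₀)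
    (hcore : Cor22.AdmitsCore P₀) (h2 : Cor22.CondP2 P₀ l₀) (hP5 : Cor22.CondP5 P₀ l₀) (h6 : Cor22.CondP6 P₀ l₀)
    (hex : Cor22.ThetaDataExistsAt P₀ l₀) :
    ∃ (TI : ∀ {P : NFPoint} {l : ℕ}, Cor22.ThetaVolumeDatumAt P l → ThetaIndex)
      (St : ∀ {P : NFPoint} {l : ℕ} (T : Cor22.ThetaVolumeDatumAt P l), LatticeSituation (TI T))
      (Pc : ∀ {P : NFPoint} {l : ℕ} (T : Cor22.ThetaVolumeDatumAt P l), Cor312.Setting (St T).toSituation)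
      (ρ : ∀ {P : NFPoint} {l : ℕ} (T : Cor22.ThetaVolumeDatumAt P l),
        (∀ v : (TI T).V, v ∈ (TI T).Vbad → Set ((St T).L.StarPacket v)) →
          ∀ (j : (TI T).Label) (vQ : (TI T).VQ), Set ((St T).L.Packet j vQ))
      (qK : ∀ {P : NFPoint} {l : ℕ} (T : Cor22.ThetaVolumeDatumAt P l),
        ∀ v : (TI T).V, v ∈ (TI T).Vbad → Set ((St T).L.StarPacket v)),
      (∀ P : NFPoint, P ∈ UP → ∀ l : ℕ, l.Prime → 5 ≤ l →
        Cor22.AdmitsCore P → Cor22.CondP2 P l → Cor22.CondP5 P l → Cor22.CondP6 P l →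
        ∀ T : Cor22.ThetaVolumeDatumAt P l,
          (letI := T.instFieldF; letI := T.instNumberFieldF; letI := T.instAlgebraF; letI := T.instFieldK
            letI := T.instNumberFieldK; letI := T.instAlgebraK; letI := T.instFieldFbar; letI := T.instAlgebraFbar
            letI := T.instAlgebraKFbar; letI := T.instIsElliptic
            Cor312Prov.IsSettingOf T.D (Pc T)) ∧
          BridgeHyps (Pc T) ∧ ((St T).col (Pc T).n).KummerB ((St T).D (Pc T).n) ∧
          PinnedRegions3 (St T) (Pc T) (ρ T) (qK T) ∧ (Pc T).negLogTheta ≤ ((T.negLogTheta : ℝ) : WithTop ℝ)) ∧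
      ¬ (∀ P : NFPoint, P ∈ UP → ∀ l : ℕ, l.Prime → 5 ≤ l →
        Cor22.AdmitsCore P → Cor22.CondP2 P l → Cor22.CondP5 P l → Cor22.CondP6 P l →
        ∀ T : Cor22.ThetaVolumeDatumAt P l, PilotKummerIndRelated (St T) (Pc T) (ρ T) (qK T)) := by
  obtain ⟨TI, St, Pc, ρ, qK, hSet, hB, hK, hpin, hΘ, hS⟩ := apex_sideBinders_satisfiable
  obtain ⟨T₀⟩ := hex
  refine ⟨TI, St, Pc, ρ, qK, fun P hP' l hl' h5' hc' h2' hP5' h6' T =>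
    ⟨hSet P hP' l hl' h5' hc' h2' hP5' h6' T, hB P hP' l hl' h5' hc' h2' hP5' h6' T, hK P hP' l hl' h5' hc' h2' hP5' h6' T,
      hpin P hP' l hl' h5' hc' h2' hP5' h6' T, hΘ P hP' l hl' h5' hc' h2' hP5' h6' T⟩, fun h => ?_⟩
  exact hS T₀ (h P₀ hP l₀ hl h5 hcore h2 hP5 h6 T₀)

end ApexNonVacuity

end Summit.ABC.IUTFork.Conditional

end
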